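import Literature.AlgebraicGeometry.HodgeTheory.ArapuraSurfaceFibredFourfoldsSplitProofs
import Literature.AlgebraicGeometry.HodgeTheory.SurfaceFamilyCupGeneration
import Literature.AlgebraicGeometry.HodgeTheory.HodgeRiemannPolarizabilityProofs
import Literature.AlgebraicGeometry.HodgeTheory.SupportedHodgeClassDescent
import Literature.AlgebraicGeometry.HodgeTheory.ClassesSupportedOn
import Literature.AlgebraicGeometry.HodgeTheory.GysinFormalismPushforward
import Literature.AlgebraicGeometry.HodgeTheory.HyperplaneClassHardLefschetzPullback
import Literature.AlgebraicGeometry.HodgeTheory.RelativeHyperplaneClassHodgeRiemann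
import Literature.AlgebraicGeometry.HodgeTheory.HypersurfaceLefschetzProofs
import Literature.NumberTheory.Transcendental.Analytification
import Literature.AlgebraicGeometry.HodgeTheory.LefschetzOneOneHolds
import Literature.AlgebraicGeometry.HodgeTheory.GysinKernelSplitHolds
import HarnessLib

/-!
# Arapura (2022), Cor. 1.5 on the smooth part: reduction to the algebraic base change

Topic `Literature/AlgebraicGeometry/HodgeTheory`, third proof file of the named fact
`Arapura2022_thm_1_2_smoothPart_pgZeroSurfaceFibration` (`ArapuraSurfaceFibredFourfoldsSplit.lean`;
D. Arapura, *Hodge cycles and the Leray filtration*, Pacific J. Math. **319** (2022), Cor. 1.5 with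
Thm. 1.2 and Cor. 1.4). `ArapuraSurfaceFibredFourfoldsSplitProofs.lean` reduced the fact to the
Hodge conjecture in dimension `≤ 3` (`h3`), Deligne's Cor. 8.2.8 (`hD`), Voisin's Cor. 2.12
(`hV`, meanwhile PROVED: `Voisin2025_hodgeClass_lift_complexGysin_holds`) and a hypothesis `hI`
mixing the algebraic base change of the proof of Cor. 1.5 with the topological generation
statement "`H⁴(V'(ℂ)) = h ∪ H²(V'(ℂ)) + Σ_i [𝒵_i] ∪ H²(V'(ℂ))`". The latter is now a theorem
(`exists_eq_cupProduct_add_sum_of_smooth_proper_family`, `SurfaceFamilyCupGeneration.lean`, from the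
Serre skeletal filtration, hard Lefschetz on the surface fibres, Andreotti–Frankel and
Milnor–Mittag-Leffler — the Leray-free form of Thm. 1.2 (proof, first reflection) plus Deligne's
degeneration). This file performs the remaining bookkeeping (transport along the open embedding
`V'(ℂ) ↪ X'(ℂ)`, graded commutativity) and states the fact's FINAL REDUCTION
`Arapura2022_thm_1_2_smoothPart_pgZeroSurfaceFibration_of_baseChange`: granted `h3` and `hD`, the
fact follows from the purely algebro-geometric output `hBC` of the proof of Cor. 1.5 — for every
`f : X ⟶ Y` as in Cor. 1.5, a smooth projective fourfold `X'` over `X` of non-zero degree carrying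
a smooth proper family `π : 𝒱 ⟶ U` of smooth projective surfaces over a smooth affine connected
surface, embedded as an open subscheme `j : 𝒱 ⟶ X'`,
(complement of `j(𝒱)` inside a proper closed `D₀`) and DIVISOR classes `[𝒵_i] ∈ N¹H²(X'(ℂ); ℂ)`
spanning, together, `H²` of ONE fibre ("after a finite base change,
`[𝒵_1], …, [𝒵_N]` gives a basis of `R²f_*ℚ`"; relative Hilbert schemes, Lefschetz `(1,1)` and
`p_g = 0`); and, `h3` being meanwhile the theorem `hodgeClasses_algebraic_of_dim_le_three_holds`,
`Arapura2022_thm_1_2_smoothPart_pgZeroSurfaceFibration_of_baseChange'` needs only `hD` and `hBC`.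
Everything here is proved; no definition and no named fact is introduced (D-0026).

## References

* D. Arapura, *Hodge cycles and the Leray filtration*, Pacific J. Math. 319 (2022) 233–258
  (arXiv:2103.05038), Thm. 1.2, Cor. 1.4, Cor. 1.5 and its proof (p. 5). [Arapura2022]
* C. Voisin, *Hodge Theory and Complex Algebraic Geometry II*, CUP (2003), Thm. 1.22, Lemma 4.13,
  Thm. 4.15. [VoisinHodgeII2003]
* A. Hatcher, *Algebraic Topology*, CUP (2002), §3.2 Prop. 3.10 and Thm. 3.11. [HatcherAT2002]
-/

noncomputable section

open Set Function CategoryTheory AlgebraicGeometry Topology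
open Literature.AlgebraicTopology.SingularHomology Literature.Geometry.Kaehler

namespace Literature.AlgebraicGeometry.HodgeTheory

section HodgeTheory

/-- **Transport of the generation statement along an embedding, in the format of `hI`.** Let
`φ : E → X` be a topological embedding with image `V = φ(E)` and `gen₀, …, gen_N ∈ H²(X; K)`. If
every class of `H⁴(E; K)` is `φ^*gen₀ ∪ w + Σ_i φ^*gen_{i+1} ∪ u_i`, then the restriction to `V` of
every `c ∈ H⁴(X; K)` lies in the span of the products `u ∪ gen_k|_V`, `u ∈ H²(V; K)` (pull back
along the homeomorphism `E ≅ V`, naturality of the cup product, graded commutativity in even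
degrees). [cite: HatcherAT2002, §3.2 Prop. 3.10 and Thm. 3.11] -/
theorem map_val_mem_span_cupProduct_of_isEmbedding (K : Type) [Field K] {E X : Type}
    [TopologicalSpace E] [TopologicalSpace X] (φ : C(E, X)) (hφ : IsEmbedding φ) {N : ℕ}
    (gen : Fin (N + 1) → singularCohomology K K X 2)
    (hgenE : ∀ c' : singularCohomology K K E 4,
      ∃ (w : singularCohomology K K E 2) (u : Fin N → singularCohomology K K E 2),
        c' = cupProduct (show 2 + 2 = 4 by rfl) (singularCohomology.map K K φ 2 (gen 0)) w +
          ∑ i, cupProduct (show 2 + 2 = 4 by rfl)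
            (singularCohomology.map K K φ 2 (gen i.succ)) (u i))
    (c : singularCohomology K K X (2 * 2)) :
    singularCohomology.map K K
        (⟨Subtype.val, continuous_subtype_val⟩ : C(↥(Set.range φ), X)) (2 * 2) c ∈
      Submodule.span K {x | ∃ (k : Fin (N + 1)) (p : ℕ) (hpk : p + 2 = 2 * 2)
        (u : singularCohomology K K ↥(Set.range φ) p),
        cupProduct hpk u (singularCohomology.map K K
          (⟨Subtype.val, continuous_subtype_val⟩ : C(↥(Set.range φ), X)) 2 (gen k)) = x} := by
  classical
  set iV : C(↥(Set.range φ), X) := ⟨Subtype.val, continuous_subtype_val⟩ with hiV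
  set θ : E ≃ₜ ↥(Set.range φ) := hφ.toHomeomorph with hθ
  have hcomp : iV.comp (θ : C(E, ↥(Set.range φ))) = φ := ContinuousMap.ext fun _ => rfl
  have hfac : ∀ n, singularCohomology.map K K φ n =
      singularCohomology.map K K iV n ≫ singularCohomology.map K K (θ : C(E, ↥(Set.range φ))) n :=
    fun n => by rw [← singularCohomology.map_comp, hcomp]
  -- `θ⁻¹^* ∘ φ^* = (·)|_V`
  have hback : ∀ n (a : singularCohomology K K X n),
      singularCohomology.map K K (θ.symm : C(↥(Set.range φ), E)) n
        (singularCohomology.map K K φ n a) = singularCohomology.map K K iV n a := fun n a => by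
    rw [hfac n, ModuleCat.comp_apply]
    change ((singularCohomology.mapIso K K θ n).hom ≫ (singularCohomology.mapIso K K θ n).inv) _ = _
    rw [Iso.hom_inv_id]
    rfl
  -- decompose `φ^* c` on `E` and push back to `V`
  obtain ⟨w, u, hwu⟩ := hgenE (singularCohomology.map K K φ 4 c)
  have key : singularCohomology.map K K iV 4 c =
      cupProduct (show 2 + 2 = 4 by rfl)
          (singularCohomology.map K K (θ.symm : C(↥(Set.range φ), E)) 2 w)
          (singularCohomology.map K K iV 2 (gen 0)) +
        ∑ i, cupProduct (show 2 + 2 = 4 by rfl)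
          (singularCohomology.map K K (θ.symm : C(↥(Set.range φ), E)) 2 (u i))
          (singularCohomology.map K K iV 2 (gen i.succ)) := by
    rw [← hback 4 c, hwu, map_add, map_sum, cupProduct_map, hback 2, cupProduct_comm_two_two K]
    congr 1
    refine Finset.sum_congr rfl fun i _ => ?_
    rw [cupProduct_map, hback 2, cupProduct_comm_two_two K]
  have key' : singularCohomology.map K K iV (2 * 2) c =
      cupProduct (show 2 + 2 = 2 * 2 by rfl)
          (singularCohomology.map K K (θ.symm : C(↥(Set.range φ), E)) 2 w)
          (singularCohomology.map K K iV 2 (gen 0)) +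
        ∑ i, cupProduct (show 2 + 2 = 2 * 2 by rfl)
          (singularCohomology.map K K (θ.symm : C(↥(Set.range φ), E)) 2 (u i))
          (singularCohomology.map K K iV 2 (gen i.succ)) := key
  rw [key']
  refine Submodule.add_mem _ (Submodule.subset_span ?_)
    (Submodule.sum_mem _ fun i _ => Submodule.subset_span ?_)
  · exact ⟨0, 2, rfl, _, rfl⟩
  · exact ⟨i.succ, 2, rfl, _, rfl⟩

/-- **Arapura (2022), Cor. 1.5 on the smooth part — final reduction to the algebraic base change.**
Granted the Hodge conjecture in dimension `≤ 3` (`h3`; Lefschetz `(1,1)` and hard Lefschetz, as in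
the proof of Cor. 1.4) and Deligne's Cor. 8.2.8 (`hD`), the `V`-part
`Arapura2022_thm_1_2_smoothPart_pgZeroSurfaceFibration` follows from the algebro-geometric output
`hBC` of the proof of Cor. 1.5: for every `f : X ⟶ Y` as there, a smooth projective fourfold `X'`
with a morphism `X' ⟶ X` of non-zero degree (the resolved finite base change), a smooth proper
family `π : 𝒱 ⟶ U` of smooth projective surfaces over a smooth affine connected surface `U`,
embedded as an open subscheme `j : 𝒱 ⟶ X'` (`𝒱 = f'⁻¹U'`, `f'` smooth over the affine `U' ⊆ Y'`)
whose complement lies in a proper Zariski-closed `D₀` (`D₀ = f'⁻¹(Y' ∖ U')`), and DIVISOR classes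
`ζ₁, …, ζ_N ∈ N¹H²(X'(ℂ); ℂ) = algebraicClasses X' 1` (the classes `[𝒵_i]` of the relative divisors)
whose restrictions span `H²` of ONE fibre `𝒱_{s₀}(ℂ)` (Lefschetz `(1,1)` and `p_g = 0` —
`algebraicClasses_one_eq_top_of_pg_zero` — and the choice of the `𝒵_i` through the relative Hilbert
scheme after the base change: "`[𝒵_1], …, [𝒵_N]` gives a basis of `R²f_*ℚ`"). Proof: the
hyperplane class `h = ι^* r₀` of a projective embedding `ι : X' ↪ ℙᴹ` is a divisor class
(`map_projectiveSpace_mem_algebraicClasses`) with the hard Lefschetz property on every fibre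
(`exists_forall_hasHardLefschetzProperty_map`; `𝒱_s ↪ 𝒱 ↪ X' ↪ ℙᴹ` is a closed immersion,
`isClosedImmersion_fiberι_comp_left_of_isPreimmersion`); each of `h, ζ_i` dies off a closed `D_k` of
codimension `≥ 1` (`exists_isClosed_of_mem_supportedClasses`); `D = D₀ ∪ ⋃_k D_k` is closed and
proper (it misses the generic point of the irreducible `X'`); the topological generation theorem
`exists_eq_cupProduct_add_sum_of_smooth_proper_family` on `𝒱(ℂ)`, transported to
`V = j(ℂ)(𝒱(ℂ)) ⊆ X'(ℂ)` (`map_val_mem_span_cupProduct_of_isEmbedding`; `j(ℂ)` is an open embedding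
with image `{P | P.pt ∈ j(𝒱)} ⊇ (X' ∖ D)(ℂ)`, SGA1 XII 1.1), is hypothesis `hI` of
`Arapura2022_thm_1_2_smoothPart_pgZeroSurfaceFibration_of_map_mem_span_cupProduct`, whose `hV` is the
theorem `Voisin2025_hodgeClass_lift_complexGysin_holds`.
[cite: Arapura2022, Thm. 1.2 (proof, first reflection), Cor. 1.4 and proof of Cor. 1.5 (p. 5)]
[cite: VoisinHodgeII2003, Thm. 1.22, Lemma 4.13 and Thm. 4.15] [cite: DeligneHodgeIII1974, Cor. 8.2.8]
[cite: VoisinHodgeI2002, Thm. 6.25 and Thm. 11.30] [cite: GrothendieckTopology1969, §1] -/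
theorem Arapura2022_thm_1_2_smoothPart_pgZeroSurfaceFibration_of_baseChange
    (h3 : hodgeClasses_algebraic_of_dim_le_three)
    (hD : Deligne1974_ker_restrictCompl_eq_iSup_range_complexGysin)
    (hBC : ∀ ⦃X Y : Motives.SchemeOver ℂ⦄ (f : X ⟶ Y),
      Motives.IsSmoothProjective 4 X → Motives.IsSmoothProjective 2 Y →
      Function.Surjective f.left.base →
      (∀ y : Y.left, _root_.IsPreconnected (f.left.base ⁻¹' {y})) →
      (∃ T : Set Y.left, IsClosed T ∧ T ≠ Set.univ ∧
        ∀ s : Motives.AlgPoints Y ℂ, s.pt ∉ T →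
          Motives.IsSmoothProjective 2 (Motives.fiberOver f s) ∧
          ∃ A : HodgeModel 2 (Motives.fiberOver f s), Module.finrank ℂ ↥(A.hodgePQ 2 2 0) = 0) →
      ∃ (X' : Motives.SchemeOver ℂ) (g : X' ⟶ X) (_ : Motives.IsSmoothProjective 4 X')
        (μ : HomologicalOrientation ℂ (Motives.ComplexPoints X') (2 * 4))
        (ν : HomologicalOrientation ℂ (Motives.ComplexPoints X) (2 * 4)) (d : ℤ),
        d ≠ 0 ∧ HasDegree μ ν (Motives.AlgPoints.mapContinuous (L := ℂ) g) d ∧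
        ∃ (U 𝒱 : Motives.SchemeOver ℂ) (π : 𝒱 ⟶ U) (j : 𝒱 ⟶ X') (_ : IsOpenImmersion j.left)
          (_ : IsAffine U.left) (_ : ConnectedSpace U.left) (_ : SmoothOfRelativeDimension 2 U.hom)
          (_ : Smooth π.left) (_ : IsProper π.left)
          (D₀ : Set X'.left) (_ : IsClosed D₀) (_ : D₀ ≠ Set.univ)
          (_ : ∀ x : X'.left, x ∉ D₀ → x ∈ j.left.opensRange)
          (_ : ∀ s : Motives.ComplexPoints U, Motives.IsSmoothProjective 2 (Motives.fiberOver π s))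
          (N : ℕ) (ζ : Fin N → complexBetti X' (2 * 1)) (_ : ∀ i, ζ i ∈ algebraicClasses X' 1)
          (s₀ : Motives.ComplexPoints U),
          Submodule.span ℂ (Set.range fun i : Fin N => singularCohomology.map ℂ ℂ
              (Motives.AlgPoints.mapContinuous (L := ℂ) (Motives.fiberι π s₀)) 2
              (singularCohomology.map ℂ ℂ (Motives.AlgPoints.mapContinuous (L := ℂ) j) 2 (ζ i))) = ⊤) :
    Arapura2022_thm_1_2_smoothPart_pgZeroSurfaceFibration := by
  classical
  refine Arapura2022_thm_1_2_smoothPart_pgZeroSurfaceFibration_of_map_mem_span_cupProduct h3 hD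
    Voisin2025_hodgeClass_lift_complexGysin_holds fun X Y f hX hY hf hconn hgen ↦ ?_
  obtain ⟨X', g, hX', μ, ν, d, hd, hdeg, U, 𝒱, π, j, hj, hUa, hUc, hUs, hπs, hπp, D₀, hD₀c,
    hD₀ne, hD₀j, hfib, N, ζ, hζ, s₀, hspan⟩ := hBC f hX hY hf hconn hgen
  haveI : IsSeparated U.hom := inferInstance
  -- the hyperplane class `h = ι^* r₀` of a projective embedding `ι : X' ↪ ℙᴹ`
  obtain ⟨r₀, hr₀⟩ := exists_forall_hasHardLefschetzProperty_map hX'.isProjectiveOver.projectiveEmbedding.n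
  -- the divisor classes `gen = (h, ζ₁, …, ζ_N)`
  obtain ⟨gen, hgen_zero, hgen_succ⟩ : ∃ gen : Fin (N + 1) → complexBetti X' (2 * 1),
      gen 0 = complexBetti.map hX'.isProjectiveOver.projectiveEmbedding.ι (2 * 1) r₀ ∧
      ∀ i, gen i.succ = ζ i :=
    ⟨Fin.cons (complexBetti.map hX'.isProjectiveOver.projectiveEmbedding.ι (2 * 1) r₀) ζ,
      rfl, fun i ↦ Fin.cons_succ _ _ i⟩
  have hgenalg : ∀ k, gen k ∈ algebraicClasses X' 1 := fun k ↦ by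
    refine Fin.cases ?_ (fun i ↦ ?_) k
    · rw [hgen_zero]
      exact map_projectiveSpace_mem_algebraicClasses hX' _ 1 r₀
    · rw [hgen_succ]
      exact hζ i
  -- hard Lefschetz for `h` on every fibre: `𝒱_s ↪ 𝒱 ↪ X' ↪ ℙᴹ` is a closed immersion
  have hHL : ∀ s : Motives.ComplexPoints U, HasHardLefschetzProperty
      (singularCohomology.map ℂ ℂ (Motives.AlgPoints.mapContinuous (L := ℂ) (Motives.fiberι π s)) 2
        (singularCohomology.map ℂ ℂ (Motives.AlgPoints.mapContinuous (L := ℂ) j) 2 (gen 0))) 2 := by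
    intro s
    haveI : IsPreimmersion (j ≫ hX'.isProjectiveOver.projectiveEmbedding.ι).left := by
      rw [Over.comp_left]; infer_instance
    haveI := isClosedImmersion_fiberι_comp_left_of_isPreimmersion π
      (j ≫ hX'.isProjectiveOver.projectiveEmbedding.ι) s
    have h := hr₀ (hfib s) (Motives.fiberι π s ≫ j ≫ hX'.isProjectiveOver.projectiveEmbedding.ι)
    have hmc : Motives.AlgPoints.mapContinuous (L := ℂ)
        (Motives.fiberι π s ≫ j ≫ hX'.isProjectiveOver.projectiveEmbedding.ι) =
        ((Motives.AlgPoints.mapContinuous (L := ℂ) hX'.isProjectiveOver.projectiveEmbedding.ι).comp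
          (Motives.AlgPoints.mapContinuous (L := ℂ) j)).comp
          (Motives.AlgPoints.mapContinuous (L := ℂ) (Motives.fiberι π s)) :=
      ContinuousMap.ext fun P ↦ by
        change Motives.AlgPoints.map _ P = Motives.AlgPoints.map _ (Motives.AlgPoints.map _
          (Motives.AlgPoints.map _ P))
        rw [Motives.AlgPoints.map_comp_apply, Motives.AlgPoints.map_comp_apply]
    rw [hmc, singularCohomology.map_comp, singularCohomology.map_comp, ModuleCat.comp_apply,
      ModuleCat.comp_apply] at h
    rw [hgen_zero]
    exact h
  -- each divisor class dies off a closed subset of codimension `≥ 1`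
  choose Dk hDkc hDkcoh hDk0 using fun k ↦ exists_isClosed_of_mem_supportedClasses (hgenalg k)
  -- `D = D₀ ∪ ⋃_k D_k` is closed and proper
  have hDc : IsClosed (D₀ ∪ ⋃ k, Dk k) := hD₀c.union (isClosed_iUnion_of_finite hDkc)
  have hDne : (D₀ ∪ ⋃ k, Dk k) ≠ Set.univ := by
    haveI := irreducibleSpace_of_isSmoothProjective' hX'
    intro hDu
    have hη : genericPoint X'.left ∈ D₀ ∪ ⋃ k, Dk k := hDu ▸ Set.mem_univ _
    rcases hη with hη | hη
    · exact hD₀ne (Set.eq_univ_of_forall fun z ↦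
        ((genericPoint_spec X'.left).specializes (Set.mem_univ z)).mem_closed hD₀c hη)
    · obtain ⟨k, hk⟩ := Set.mem_iUnion.1 hη
      have h := hDkcoh k _ hk
      have hmax : IsMax (genericPoint X'.left) := fun z _ ↦
        Scheme.le_iff_specializes.2 ((genericPoint_spec X'.left).specializes (Set.mem_univ z))
      rw [Order.coheight_eq_zero.2 hmax] at h
      exact absurd h (by simp)
  have hgen0 : ∀ k, complexBetti.restrictCompl X' (D₀ ∪ ⋃ k, Dk k) 2 (gen k) = 0 := fun k ↦ by
    have hsub : Dk k ⊆ D₀ ∪ ⋃ k, Dk k :=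
      Set.subset_union_of_subset_right (Set.subset_iUnion _ k) _
    have h' : complexBetti.restrictCompl X' (Dk k) 2 (gen k) = 0 := hDk0 k
    rw [restrictCompl_eq_comp hsub 2, ModuleCat.comp_apply, h', map_zero]
  refine ⟨X', g, hX', μ, ν, d, hd, hdeg, D₀ ∪ ⋃ k, Dk k, hDc, hDne,
    Set.range (Motives.AlgPoints.map j : Motives.ComplexPoints 𝒱 → Motives.ComplexPoints X'),
    fun P hP ↦ ?_, N + 1, fun _ ↦ 2, gen, hgen0, fun c ↦ ?_⟩
  · -- `(X' ∖ D)(ℂ) ⊆ (X' ∖ D₀)(ℂ) ⊆ j(𝒱)(ℂ) = j(ℂ)(𝒱(ℂ))`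
    rw [Motives.AlgPoints.range_map_of_isOpenImmersion_holds j]
    exact hD₀j P.pt fun h ↦ hP (Set.mem_union_left _ h)
  · -- the generation theorem on `𝒱(ℂ)`, transported to `j(ℂ)(𝒱(ℂ)) ⊆ X'(ℂ)`
    have hspan' : Submodule.span ℂ (Set.range fun i : Fin N => singularCohomology.map ℂ ℂ
        (Motives.AlgPoints.mapContinuous (L := ℂ) (Motives.fiberι π s₀)) 2
        (singularCohomology.map ℂ ℂ (Motives.AlgPoints.mapContinuous (L := ℂ) j) 2
          (gen i.succ))) = ⊤ := by
      simp_rw [hgen_succ]; exact hspan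
    exact map_val_mem_span_cupProduct_of_isEmbedding ℂ (Motives.AlgPoints.mapContinuous (L := ℂ) j)
      (Motives.AlgPoints.isOpenEmbedding_map_holds j).toIsEmbedding gen
      (fun c' ↦ exists_eq_cupProduct_add_sum_of_smooth_proper_family π
        (singularCohomology.map ℂ ℂ (Motives.AlgPoints.mapContinuous (L := ℂ) j) 2 (gen 0))
        (fun i : Fin N ↦ singularCohomology.map ℂ ℂ
          (Motives.AlgPoints.mapContinuous (L := ℂ) j) 2 (gen i.succ))
        hHL (hfib s₀) hspan' c') c

/-- **Arapura (2022), Cor. 1.5 on the smooth part from Deligne's Cor. 8.2.8 and the algebraic base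
change alone.** The Hodge conjecture in dimension `≤ 3` being meanwhile a theorem of the tree
(`hodgeClasses_algebraic_of_dim_le_three_holds`: Lefschetz `(1,1)` via Kodaira–Serre and GAGA, hard
Lefschetz for threefolds), the reduction `…_of_baseChange` needs only `hD` (Deligne, Hodge III,
Cor. 8.2.8) and the algebro-geometric output `hBC` of the proof of Cor. 1.5 (finite base change and
relative divisors spanning `H²` of one fibre; see `…_of_baseChange`).
[cite: Arapura2022, Thm. 1.2 (proof, first reflection), Cor. 1.4 and proof of Cor. 1.5 (p. 5)]
[cite: DeligneHodgeIII1974, Cor. 8.2.8] [cite: VoisinHodgeII2003, §10.2.3 proof of Prop. 10.26] -/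
theorem Arapura2022_thm_1_2_smoothPart_pgZeroSurfaceFibration_of_baseChange'
    (hD : Deligne1974_ker_restrictCompl_eq_iSup_range_complexGysin)
    (hBC : ∀ ⦃X Y : Motives.SchemeOver ℂ⦄ (f : X ⟶ Y),
      Motives.IsSmoothProjective 4 X → Motives.IsSmoothProjective 2 Y →
      Function.Surjective f.left.base →
      (∀ y : Y.left, _root_.IsPreconnected (f.left.base ⁻¹' {y})) →
      (∃ T : Set Y.left, IsClosed T ∧ T ≠ Set.univ ∧
        ∀ s : Motives.AlgPoints Y ℂ, s.pt ∉ T →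
          Motives.IsSmoothProjective 2 (Motives.fiberOver f s) ∧
          ∃ A : HodgeModel 2 (Motives.fiberOver f s), Module.finrank ℂ ↥(A.hodgePQ 2 2 0) = 0) →
      ∃ (X' : Motives.SchemeOver ℂ) (g : X' ⟶ X) (_ : Motives.IsSmoothProjective 4 X')
        (μ : HomologicalOrientation ℂ (Motives.ComplexPoints X') (2 * 4))
        (ν : HomologicalOrientation ℂ (Motives.ComplexPoints X) (2 * 4)) (d : ℤ),
        d ≠ 0 ∧ HasDegree μ ν (Motives.AlgPoints.mapContinuous (L := ℂ) g) d ∧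
        ∃ (U 𝒱 : Motives.SchemeOver ℂ) (π : 𝒱 ⟶ U) (j : 𝒱 ⟶ X') (_ : IsOpenImmersion j.left)
          (_ : IsAffine U.left) (_ : ConnectedSpace U.left) (_ : SmoothOfRelativeDimension 2 U.hom)
          (_ : Smooth π.left) (_ : IsProper π.left)
          (D₀ : Set X'.left) (_ : IsClosed D₀) (_ : D₀ ≠ Set.univ)
          (_ : ∀ x : X'.left, x ∉ D₀ → x ∈ j.left.opensRange)
          (_ : ∀ s : Motives.ComplexPoints U, Motives.IsSmoothProjective 2 (Motives.fiberOver π s))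
          (N : ℕ) (ζ : Fin N → complexBetti X' (2 * 1)) (_ : ∀ i, ζ i ∈ algebraicClasses X' 1)
          (s₀ : Motives.ComplexPoints U),
          Submodule.span ℂ (Set.range fun i : Fin N => singularCohomology.map ℂ ℂ
              (Motives.AlgPoints.mapContinuous (L := ℂ) (Motives.fiberι π s₀)) 2
              (singularCohomology.map ℂ ℂ (Motives.AlgPoints.mapContinuous (L := ℂ) j) 2 (ζ i))) = ⊤) :
    Arapura2022_thm_1_2_smoothPart_pgZeroSurfaceFibration :=
  Arapura2022_thm_1_2_smoothPart_pgZeroSurfaceFibration_of_baseChange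
    hodgeClasses_algebraic_of_dim_le_three_holds hD hBC

/-- **Arapura (2022), Cor. 1.5 on the smooth part from the algebraic base change ALONE.** Deligne's
Cor. 8.2.8 being meanwhile a theorem of the tree
(`Deligne1974_ker_restrictCompl_eq_iSup_range_complexGysin_holds_of
Deligne1974_ker_pullback_eq_ker_pullback_resolution_holds`: log resolution, the `∂∂̄`-lemma on the
strata and tautness, `GysinKernelSplitHolds.lean`), the named fact
`Arapura2022_thm_1_2_smoothPart_pgZeroSurfaceFibration` is reduced to the purely algebro-geometric
output `hBC` of the printed proof of Cor. 1.5 (p. 5: "after a finite base change,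
`[𝒵_1], …, [𝒵_N]` gives a basis of `R²f_*ℚ`" — a smooth projective fourfold `X' → X` of
non-zero degree carrying a smooth proper family of smooth projective surfaces over a smooth affine
connected surface as a dense open subscheme, and divisor classes on `X'` spanning `H²` of one
fibre; relative Hilbert schemes `Hilb_{X/Y}` and Lefschetz `(1,1)` with `p_g = 0`). Everything
else in the printed proof (Thm. 1.2, Cor. 1.4, Lemma 1.2, Deligne's degeneration, hard Lefschetz
on the fibres and on the intersection cohomology of the base, the Hodge conjecture in dimension
`≤ 3`, Deligne's Cor. 8.2.8, Voisin's Cor. 2.12) is discharged by theorems of the tree.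
[cite: Arapura2022, Thm. 1.2, Cor. 1.4 and proof of Cor. 1.5 (p. 5)]
[cite: DeligneHodgeIII1974, Prop. 8.2.7 and Cor. 8.2.8] -/
theorem Arapura2022_thm_1_2_smoothPart_pgZeroSurfaceFibration_of_baseChange''
    (hBC : ∀ ⦃X Y : Motives.SchemeOver ℂ⦄ (f : X ⟶ Y),
      Motives.IsSmoothProjective 4 X → Motives.IsSmoothProjective 2 Y →
      Function.Surjective f.left.base →
      (∀ y : Y.left, _root_.IsPreconnected (f.left.base ⁻¹' {y})) →
      (∃ T : Set Y.left, IsClosed T ∧ T ≠ Set.univ ∧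
        ∀ s : Motives.AlgPoints Y ℂ, s.pt ∉ T →
          Motives.IsSmoothProjective 2 (Motives.fiberOver f s) ∧
          ∃ A : HodgeModel 2 (Motives.fiberOver f s), Module.finrank ℂ ↥(A.hodgePQ 2 2 0) = 0) →
      ∃ (X' : Motives.SchemeOver ℂ) (g : X' ⟶ X) (_ : Motives.IsSmoothProjective 4 X')
        (μ : HomologicalOrientation ℂ (Motives.ComplexPoints X') (2 * 4))
        (ν : HomologicalOrientation ℂ (Motives.ComplexPoints X) (2 * 4)) (d : ℤ),
        d ≠ 0 ∧ HasDegree μ ν (Motives.AlgPoints.mapContinuous (L := ℂ) g) d ∧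
        ∃ (U 𝒱 : Motives.SchemeOver ℂ) (π : 𝒱 ⟶ U) (j : 𝒱 ⟶ X') (_ : IsOpenImmersion j.left)
          (_ : IsAffine U.left) (_ : ConnectedSpace U.left) (_ : SmoothOfRelativeDimension 2 U.hom)
          (_ : Smooth π.left) (_ : IsProper π.left)
          (D₀ : Set X'.left) (_ : IsClosed D₀) (_ : D₀ ≠ Set.univ)
          (_ : ∀ x : X'.left, x ∉ D₀ → x ∈ j.left.opensRange)
          (_ : ∀ s : Motives.ComplexPoints U, Motives.IsSmoothProjective 2 (Motives.fiberOver π s))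
          (N : ℕ) (ζ : Fin N → complexBetti X' (2 * 1)) (_ : ∀ i, ζ i ∈ algebraicClasses X' 1)
          (s₀ : Motives.ComplexPoints U),
          Submodule.span ℂ (Set.range fun i : Fin N => singularCohomology.map ℂ ℂ
              (Motives.AlgPoints.mapContinuous (L := ℂ) (Motives.fiberι π s₀)) 2
              (singularCohomology.map ℂ ℂ (Motives.AlgPoints.mapContinuous (L := ℂ) j) 2 (ζ i))) = ⊤) :
    Arapura2022_thm_1_2_smoothPart_pgZeroSurfaceFibration :=
  Arapura2022_thm_1_2_smoothPart_pgZeroSurfaceFibration_of_baseChange'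
    (Deligne1974_ker_restrictCompl_eq_iSup_range_complexGysin_holds_of
      Deligne1974_ker_pullback_eq_ker_pullback_resolution_holds) hBC

end HodgeTheory

end Literature.AlgebraicGeometry.HodgeTheory

end
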